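import Mathlib
import HarnessLib
import Summits.Ventures.LatticeQCDFlow.Scoring.BlockMartingaleFourthMomentLeading

/-!
# The LEADING CONSTANT of the fourth moment of a block sum, from any start, under a geometric
# sup-norm envelope: `|E_{μ₀}[(Σ_{t<n} f̄(X_{s+t}))⁴] − 3 σ⁴_f n²| ≤ K n √n`

HONEST FRAMING: exact (Metropolis-corrected) sampling algorithms for lattice gauge theory;
figures of merit are autocorrelation/cost numbers at stated couplings and volumes; no
continuum-physics claim.

Venture `LatticeQCDFlow` (cell pub-lqcd), topic `Scoring`; FANOUT row 8 (`s0-cpn-nemc`, GEN-21).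
NEW WORK of the cell, not a published result; no definition is introduced; nothing is cited as a
fact.  GEN-20 (`Scoring/GeometricEnvelopeBlockSumMoments.lean`) bounded the fourth moment of a block
sum by `512 C_h⁴ n²` (`C_h = 4CA/(1−ρ)`).  With the martingale's leading constant
(`Scoring/BlockMartingaleFourthMomentLeading.lean`: `|E M_{s,n}⁴ − 3 (πq)² n²| ≤ (K₂ + 35 C_h⁴) n √n`), the
telescoping `S_{s,n} = M_{s,n} + h(X_s) − h(X_{s+n})` of a Poisson solution `h` (`|h| ≤ C_h`,
`Scoring/ChainMartingaleFourthMoment.blockSum_eq_blockMartingale_add`) and `πq = σ²_f`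
(`poisson_condVar_integral_eq_greenKubo_of_envelope`), the block sum inherits the constant:
pointwise `|S⁴ − M⁴| ≤ 8 C_h M²|M| + 24 C_h² M² + 32 C_h³ |M| + 16 C_h⁴` (`|Δ| ≤ 2 C_h`), and
`16 C_h √n · M²|M| ≤ M⁴ + 64 C_h² n M²` (a square) with `E M⁴ ≤ 48 C_h⁴ n²`, `E M² ≤ n C_h²`,
`E|M| ≤ C_h √n` give `|E S⁴ − E M⁴| ≤ 128 C_h⁴ n √n`, hence
`|E_{μ₀}[S_{s,n}⁴] − 3 σ⁴_f n²| ≤ (K₂ + 163 C_h⁴) n √n` for EVERY start, block position and `n ≥ 1`.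
READING: `b² E (B_j − πf)⁴ → 3 σ⁴_f` at rate `b^{−1/2}` — the Gaussian fourth moment of a batch
mean — so `Var(b (B_j − πf)²) → 2 σ⁴_f`, the per-batch constant of the `2 σ⁴_f/a` variance of the
batch-means estimator (`Scoring/BatchMeansVarianceLeading.lean`).  Printed counterpart NAMED ONLY:
moment convergence in the Markov-chain CLT (Ibragimov–Linnik 1971 Ch. 18; Jones 2004 survey),
nothing cited as a fact.

## Content (envelope `(A, ρ)`, `0 ≤ A`, `0 ≤ ρ < 1`, `π` invariant; `|f| ≤ C` measurable,
## `θ = 4CA/(1−ρ)`; `P_{μ₀}` from ANY `μ₀`)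

* `abs_pow_four_sub_pow_four_le` — the pointwise bound for `(m + δ)⁴ − m⁴`, `|δ| ≤ 2 C_h`;
* `chain_blockMartingale_cube_le` — `E_{μ₀}[8 C_h M²|M|] ≤ 56 C_h⁴ n √n` (`n ≥ 1`);
* **`abs_chain_blockSum_fourth_sub_leading_le_of_envelope`** — for every `μ₀`, `s`, `n ≥ 1`:
  `|E_{μ₀}[(Σ_{t<n} (f(X_{s+t}) − πf))⁴] − 3 σ⁴_f n²| ≤ K_S n √n`,
  `K_S = 12 θ⁴ A/(1−ρ) + 6 (8 θ⁴ A + 32 θ⁴ A²/(1−ρ))/(1−ρ) + 179 θ⁴`.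

NOT CLAIMED: the `O(n)` remainder; unbounded observables; anything about a concrete sampler.
-/

noncomputable section

namespace Summit.Ventures.LatticeQCDFlow.Scoring

open MeasureTheory ProbabilityTheory Filter Finset Preorder Literature.Probability.MarkovChains
open scoped ENNReal Topology

variable {Ω : Type*} [MeasurableSpace Ω]

omit [MeasurableSpace Ω] in
/-- Pointwise: for `|δ| ≤ 2c`,
`|(m + δ)⁴ − m⁴| ≤ 8 c m²|m| + 24 c² m² + 32 c³ |m| + 16 c⁴`. -/
theorem abs_pow_four_sub_pow_four_le {m δ c : ℝ} (hδ : |δ| ≤ 2 * c) :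
    |(m + δ) ^ 4 - m ^ 4| ≤ 8 * c * (m ^ 2 * |m|) + 24 * c ^ 2 * m ^ 2 + 32 * c ^ 3 * |m|
      + 16 * c ^ 4 := by
  have hd0 : 0 ≤ |δ| := abs_nonneg _
  have hm0 : 0 ≤ |m| := abs_nonneg _
  have hexp : (m + δ) ^ 4 - m ^ 4 = 4 * (m ^ 3 * δ) + 6 * (m ^ 2 * δ ^ 2) + 4 * (m * δ ^ 3) + δ ^ 4 := by
    ring
  rw [hexp]
  have h1 : |4 * (m ^ 3 * δ)| ≤ 8 * c * (m ^ 2 * |m|) := by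
    rw [abs_mul, show |(4 : ℝ)| = 4 from abs_of_pos (by norm_num), abs_mul, abs_pow,
      show |m| ^ 3 = m ^ 2 * |m| by rw [pow_succ, sq_abs]]
    calc 4 * (m ^ 2 * |m| * |δ|) ≤ 4 * (m ^ 2 * |m| * (2 * c)) :=
          mul_le_mul_of_nonneg_left (mul_le_mul_of_nonneg_left hδ (by positivity)) (by norm_num)
      _ = 8 * c * (m ^ 2 * |m|) := by ring
  have hδ2 : δ ^ 2 ≤ (2 * c) ^ 2 := by
    calc δ ^ 2 = |δ| ^ 2 := (sq_abs δ).symm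
      _ ≤ (2 * c) ^ 2 := pow_le_pow_left₀ hd0 hδ 2
  have hδ3 : |δ| ^ 3 ≤ (2 * c) ^ 3 := pow_le_pow_left₀ hd0 hδ 3
  have hδ4 : δ ^ 4 ≤ (2 * c) ^ 4 := by
    calc δ ^ 4 = |δ| ^ 4 := by rw [show (4 : ℕ) = 2 * 2 from rfl, pow_mul, pow_mul, sq_abs]
      _ ≤ (2 * c) ^ 4 := pow_le_pow_left₀ hd0 hδ 4
  have h2 : |6 * (m ^ 2 * δ ^ 2)| ≤ 24 * c ^ 2 * m ^ 2 := by
    rw [abs_of_nonneg (by positivity)]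
    calc 6 * (m ^ 2 * δ ^ 2) ≤ 6 * (m ^ 2 * (2 * c) ^ 2) :=
          mul_le_mul_of_nonneg_left (mul_le_mul_of_nonneg_left hδ2 (sq_nonneg _)) (by norm_num)
      _ = 24 * c ^ 2 * m ^ 2 := by ring
  have h3 : |4 * (m * δ ^ 3)| ≤ 32 * c ^ 3 * |m| := by
    rw [abs_mul, show |(4 : ℝ)| = 4 from abs_of_pos (by norm_num), abs_mul, abs_pow]
    calc 4 * (|m| * |δ| ^ 3) ≤ 4 * (|m| * (2 * c) ^ 3) :=
          mul_le_mul_of_nonneg_left (mul_le_mul_of_nonneg_left hδ3 hm0) (by norm_num)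
      _ = 32 * c ^ 3 * |m| := by ring
  have h4 : |δ ^ 4| ≤ 16 * c ^ 4 := by
    rw [abs_of_nonneg (by positivity)]
    calc δ ^ 4 ≤ (2 * c) ^ 4 := hδ4
      _ = 16 * c ^ 4 := by ring
  calc |4 * (m ^ 3 * δ) + 6 * (m ^ 2 * δ ^ 2) + 4 * (m * δ ^ 3) + δ ^ 4|
      ≤ |4 * (m ^ 3 * δ)| + |6 * (m ^ 2 * δ ^ 2)| + |4 * (m * δ ^ 3)| + |δ ^ 4| :=
        (abs_add_le _ _).trans (add_le_add ((abs_add_le _ _).trans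
          (add_le_add (abs_add_le _ _) le_rfl)) le_rfl)
    _ ≤ _ := add_le_add (add_le_add (add_le_add h1 h2) h3) h4

section Martingale

variable (κ : Kernel Ω Ω) [IsMarkovKernel κ] (μ₀ : Measure Ω) [IsProbabilityMeasure μ₀]

/-- **`E_{μ₀}[8 C_h M²|M|] ≤ 56 C_h⁴ n √n`** for `n ≥ 1` (from `16 C_h √n M²|M| ≤ M⁴ + 64 C_h² n M²`
pointwise, `E M⁴ ≤ 48 C_h⁴ n²`, `E M² ≤ n C_h²`). -/
theorem chain_blockMartingale_cube_le {h : Ω → ℝ} (hh : Measurable h) {Ch : ℝ}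
    (hCh : ∀ x, |h x| ≤ Ch) (s : ℕ) {n : ℕ} (hn : n ≠ 0) :
    ∫ x, 8 * Ch * ((∑ t ∈ Finset.range n, (h (x (s + t + 1)) - kop κ h (x (s + t)))) ^ 2
        * |∑ t ∈ Finset.range n, (h (x (s + t + 1)) - kop κ h (x (s + t)))|)
        ∂(Kernel.trajMeasure (X := fun _ : ℕ => Ω) μ₀
          (fun n : ℕ => κ.comap (fun h : (i : ↥(Finset.Iic n)) → Ω => h ⟨n, Finset.mem_Iic.2 le_rfl⟩)
            (measurable_pi_apply _)))
      ≤ 56 * Ch ^ 4 * (n * Real.sqrt n) := by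
  set P := Kernel.trajMeasure (X := fun _ : ℕ => Ω) μ₀
      (fun n : ℕ => κ.comap (fun h : (i : ↥(Finset.Iic n)) → Ω => h ⟨n, Finset.mem_Iic.2 le_rfl⟩)
        (measurable_pi_apply _)) with hP
  have hCh0 : 0 ≤ Ch := (abs_nonneg _).trans (hCh (Classical.choice
    (nonempty_of_isProbabilityMeasure μ₀)))
  set M : (ℕ → Ω) → ℝ := fun x => ∑ t ∈ Finset.range n, (h (x (s + t + 1)) - kop κ h (x (s + t)))
    with hM
  have hMm : Measurable M := blockMartingale_measurable κ hh s n
  have hMb : ∀ x, |M x| ≤ n * (2 * Ch) := fun x => abs_blockMartingale_le κ hCh s n x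
  have hB0 : 0 ≤ (n : ℝ) * (2 * Ch) := by positivity
  have hn1 : (1 : ℝ) ≤ n := Nat.one_le_cast.2 (Nat.pos_of_ne_zero hn)
  have hn0 : (0 : ℝ) ≤ n := by linarith
  have hs0 : 0 < Real.sqrt n := Real.sqrt_pos.2 (by linarith)
  have hss : Real.sqrt n * Real.sqrt n = n := Real.mul_self_sqrt hn0
  -- moments
  have hM4 := chain_blockMartingale_fourth_le' κ μ₀ hh hCh s hn
  have hM2 := chain_blockMartingale_sq_le κ μ₀ hh hCh s n
  rw [← hP] at hM4 hM2
  -- pointwise square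
  have hpt : ∀ x : ℕ → Ω, 16 * Ch * Real.sqrt n * (M x ^ 2 * |M x|)
      ≤ M x ^ 4 + 64 * Ch ^ 2 * n * M x ^ 2 := by
    intro x
    have hsq := sq_nonneg (M x ^ 2 - 8 * Ch * Real.sqrt n * |M x|)
    have habs : |M x| ^ 2 = M x ^ 2 := sq_abs _
    have hid : (M x ^ 2 - 8 * Ch * Real.sqrt n * |M x|) ^ 2
        = M x ^ 4 - 16 * Ch * Real.sqrt n * (M x ^ 2 * |M x|)
          + 64 * Ch ^ 2 * (Real.sqrt n * Real.sqrt n) * |M x| ^ 2 := by ring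
    rw [hid, hss, habs] at hsq
    linarith
  -- integrability
  have hm3 : Measurable (fun x => M x ^ 2 * |M x|) :=
    (hMm.pow_const 2).mul (continuous_abs.measurable.comp hMm)
  have hi3 : Integrable (fun x => M x ^ 2 * |M x|) P :=
    integrable_of_bounded P hm3 (C := (n * (2 * Ch)) ^ 2 * (n * (2 * Ch))) fun x => by
        rw [abs_mul, abs_abs, abs_pow]
        exact mul_le_mul (pow_le_pow_left₀ (abs_nonneg _) (hMb x) 2) (hMb x) (abs_nonneg _)
          (by positivity)
  have hi4 : Integrable (fun x => M x ^ 4) P :=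
    integrable_of_bounded P (hMm.pow_const 4) (C := (n * (2 * Ch)) ^ 4) fun x => by
      rw [abs_pow]; exact pow_le_pow_left₀ (abs_nonneg _) (hMb x) 4
  have hi2 : Integrable (fun x => M x ^ 2) P :=
    integrable_of_bounded P (hMm.pow_const 2) (C := (n * (2 * Ch)) ^ 2) fun x => by
      rw [abs_pow]; exact pow_le_pow_left₀ (abs_nonneg _) (hMb x) 2
  have hint : 16 * Ch * Real.sqrt n * ∫ x, M x ^ 2 * |M x| ∂P
      ≤ ∫ x, M x ^ 4 ∂P + 64 * Ch ^ 2 * n * ∫ x, M x ^ 2 ∂P := by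
    rw [← integral_const_mul, ← integral_const_mul, ← integral_add hi4 (hi2.const_mul _)]
    exact integral_mono (hi3.const_mul _) (hi4.add (hi2.const_mul _)) hpt
  have hup : 16 * Ch * Real.sqrt n * ∫ x, M x ^ 2 * |M x| ∂P ≤ 112 * Ch ^ 4 * (n : ℝ) ^ 2 := by
    calc 16 * Ch * Real.sqrt n * ∫ x, M x ^ 2 * |M x| ∂P
        ≤ ∫ x, M x ^ 4 ∂P + 64 * Ch ^ 2 * n * ∫ x, M x ^ 2 ∂P := hint
      _ ≤ 48 * Ch ^ 4 * (n : ℝ) ^ 2 + 64 * Ch ^ 2 * n * (n * Ch ^ 2) :=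
          add_le_add hM4 (mul_le_mul_of_nonneg_left hM2 (by positivity))
      _ = 112 * Ch ^ 4 * (n : ℝ) ^ 2 := by ring
  -- divide by `2 √n`
  rw [integral_const_mul]
  have hI0 : 0 ≤ ∫ x, M x ^ 2 * |M x| ∂P := integral_nonneg fun x => by positivity
  have hkey : 8 * Ch * ∫ x, M x ^ 2 * |M x| ∂P ≤ 56 * Ch ^ 4 * (n * Real.sqrt n) := by
    -- multiply the target by `2 √n > 0`
    have h2 : (8 * Ch * ∫ x, M x ^ 2 * |M x| ∂P) * (2 * Real.sqrt n)
        ≤ (56 * Ch ^ 4 * (n * Real.sqrt n)) * (2 * Real.sqrt n) := by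
      calc (8 * Ch * ∫ x, M x ^ 2 * |M x| ∂P) * (2 * Real.sqrt n)
          = 16 * Ch * Real.sqrt n * ∫ x, M x ^ 2 * |M x| ∂P := by ring
        _ ≤ 112 * Ch ^ 4 * (n : ℝ) ^ 2 := hup
        _ = (56 * Ch ^ 4 * (n * Real.sqrt n)) * (2 * Real.sqrt n) := by
            rw [show (n : ℝ) ^ 2 = n * (Real.sqrt n * Real.sqrt n) by rw [hss, sq]]; ring
    exact le_of_mul_le_mul_right h2 (by positivity)
  exact hkey

end Martingale

section Envelope

variable {κ : Kernel Ω Ω} [IsMarkovKernel κ] {π : Measure Ω} [IsProbabilityMeasure π] {A ρ : ℝ}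
  (μ₀ : Measure Ω) [IsProbabilityMeasure μ₀]

/-- **THE FOURTH MOMENT OF A BLOCK SUM IS `3 σ⁴_f n² + O(n^{3/2})`, FROM ANY START, UNDER THE
ENVELOPE.**  `π` invariant, envelope `(A, ρ)` (`0 ≤ A`, `0 ≤ ρ < 1`), `|f| ≤ C` measurable,
`θ = 4CA/(1−ρ)`, `σ²_f` the Green–Kubo variance; for EVERY `μ₀`, `s` and `n ≥ 1`:
`|E_{μ₀}[(Σ_{t<n} (f(X_{s+t}) − πf))⁴] − 3 σ⁴_f n²| ≤ K_S n √n`,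
`K_S = 12 θ⁴ A/(1−ρ) + 6 (8 θ⁴ A + 32 θ⁴ A²/(1−ρ))/(1−ρ) + 179 θ⁴`. -/
theorem abs_chain_blockSum_fourth_sub_leading_le_of_envelope (hπ : Kernel.Invariant κ π)
    (henv : ∀ (g : Ω → ℝ), Measurable g → ∀ (Cg : ℝ), (∀ x, |g x| ≤ Cg) →
      ∀ (t : ℕ) (x : Ω), |(kop κ)^[t] g x - ∫ y, g y ∂π| ≤ 2 * Cg * (A * ρ ^ t))
    (hA : 0 ≤ A) (hρ0 : 0 ≤ ρ) (hρ1 : ρ < 1)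
    {f : Ω → ℝ} (hf : Measurable f) {C : ℝ} (hC : ∀ x, |f x| ≤ C) (s : ℕ) {n : ℕ} (hn : n ≠ 0) :
    |∫ x, (∑ t ∈ Finset.range n, (f (x (s + t)) - ∫ z, f z ∂π)) ^ 4
        ∂(Kernel.trajMeasure (X := fun _ : ℕ => Ω) μ₀
          (fun n : ℕ => κ.comap (fun h : (i : ↥(Finset.Iic n)) → Ω => h ⟨n, Finset.mem_Iic.2 le_rfl⟩)
            (measurable_pi_apply _)))
      - 3 * ((∫ y, (f y - ∫ z, f z ∂π) ^ 2 ∂π)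
          + 2 * ∑' k, ∫ y, (f y - ∫ z, f z ∂π) * (kop κ)^[k + 1] (fun y => f y - ∫ z, f z ∂π) y ∂π) ^ 2
        * (n : ℝ) ^ 2|
      ≤ (12 * (4 * C * A / (1 - ρ)) ^ 4 * A / (1 - ρ)
          + 6 * ((8 * (4 * C * A / (1 - ρ)) ^ 4 * A + 32 * (4 * C * A / (1 - ρ)) ^ 4 * A ^ 2 / (1 - ρ))
            / (1 - ρ))
          + 179 * (4 * C * A / (1 - ρ)) ^ 4) * (n * Real.sqrt n) := by
  set P := Kernel.trajMeasure (X := fun _ : ℕ => Ω) μ₀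
      (fun n : ℕ => κ.comap (fun h : (i : ↥(Finset.Iic n)) → Ω => h ⟨n, Finset.mem_Iic.2 le_rfl⟩)
        (measurable_pi_apply _)) with hP
  set c := ∫ z, f z ∂π with hc
  obtain ⟨hfb, hCfb, -⟩ := centred_observable_bounds π hf hC
  obtain ⟨h, hh, hCh, hpois⟩ := poisson_exists_of_geometricEnvelope henv hρ0 hρ1 hf hC
  set θ : ℝ := 4 * C * A / (1 - ρ) with hθ
  have h1ρ : 0 < 1 - ρ := sub_pos.2 hρ1
  have hC0 : 0 ≤ C := (abs_nonneg _).trans (hC (Classical.choice (nonempty_of_isProbabilityMeasure π)))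
  have hθ0 : 0 ≤ θ := by positivity
  -- `σ²_f = πq`
  have hσ := poisson_condVar_integral_eq_greenKubo_of_envelope hπ henv hρ0 hρ1 hf hC hh hCh hpois
  rw [← hσ]
  set mq : ℝ := ∫ y, (kop κ (fun z => h z ^ 2) y - (kop κ h y) ^ 2) ∂π with hmq
  -- the martingale and the telescoping
  set M : (ℕ → Ω) → ℝ := fun x => ∑ t ∈ Finset.range n, (h (x (s + t + 1)) - kop κ h (x (s + t)))
    with hM
  have hMm : Measurable M := blockMartingale_measurable κ hh s n
  have hMb : ∀ x, |M x| ≤ n * (2 * θ) := fun x => abs_blockMartingale_le κ hCh s n x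
  have hB0 : 0 ≤ (n : ℝ) * (2 * θ) := by positivity
  have htel : ∀ x : ℕ → Ω, ∑ t ∈ Finset.range n, (f (x (s + t)) - c) = M x + (h (x s) - h (x (s + n))) :=
    fun x => by rw [blockSum_eq_blockMartingale_add (kop κ) hpois s n x]; ring
  have hΔ : ∀ x : ℕ → Ω, |h (x s) - h (x (s + n))| ≤ 2 * θ := fun x =>
    (abs_sub _ _).trans (by linarith [hCh (x s), hCh (x (s + n))])
  -- pointwise bound on `S⁴ − M⁴`
  have hpt : ∀ x : ℕ → Ω, |(∑ t ∈ Finset.range n, (f (x (s + t)) - c)) ^ 4 - M x ^ 4|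
      ≤ 8 * θ * (M x ^ 2 * |M x|) + 24 * θ ^ 2 * M x ^ 2 + 32 * θ ^ 3 * |M x| + 16 * θ ^ 4 := by
    intro x
    rw [htel x]
    exact abs_pow_four_sub_pow_four_le (hΔ x)
  -- integrability
  have hSm : Measurable fun x : ℕ → Ω => (∑ t ∈ Finset.range n, (f (x (s + t)) - c)) ^ 4 :=
    (Finset.measurable_sum _ fun t _ => hfb.comp (measurable_pi_apply _)).pow_const 4
  have hSb : ∀ x : ℕ → Ω, |(∑ t ∈ Finset.range n, (f (x (s + t)) - c)) ^ 4| ≤ (n * (2 * C)) ^ 4 :=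
    fun x => by
      rw [abs_pow]
      refine pow_le_pow_left₀ (abs_nonneg _) ?_ 4
      exact (Finset.abs_sum_le_sum_abs _ _).trans ((Finset.sum_le_sum fun t _ => hCfb _).trans
        (by rw [Finset.sum_const, Finset.card_range, nsmul_eq_mul]))
  have hiS : Integrable (fun x : ℕ → Ω => (∑ t ∈ Finset.range n, (f (x (s + t)) - c)) ^ 4) P :=
    integrable_of_bounded P hSm hSb
  have hiM4 : Integrable (fun x => M x ^ 4) P :=
    integrable_of_bounded P (hMm.pow_const 4) (C := (n * (2 * θ)) ^ 4) fun x => by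
      rw [abs_pow]; exact pow_le_pow_left₀ (abs_nonneg _) (hMb x) 4
  have hiM2 : Integrable (fun x => M x ^ 2) P :=
    integrable_of_bounded P (hMm.pow_const 2) (C := (n * (2 * θ)) ^ 2) fun x => by
      rw [abs_pow]; exact pow_le_pow_left₀ (abs_nonneg _) (hMb x) 2
  have hiMa : Integrable (fun x => |M x|) P := (integrable_of_bounded P hMm hMb).abs
  have hm3 : Measurable (fun x => M x ^ 2 * |M x|) :=
    (hMm.pow_const 2).mul (continuous_abs.measurable.comp hMm)
  have hi3' : Integrable (fun x => M x ^ 2 * |M x|) P :=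
    integrable_of_bounded P hm3 (C := (n * (2 * θ)) ^ 2 * (n * (2 * θ))) fun x => by
      rw [abs_mul, abs_abs, abs_pow]
      exact mul_le_mul (pow_le_pow_left₀ (abs_nonneg _) (hMb x) 2) (hMb x) (abs_nonneg _)
        (by positivity)
  have hi3 : Integrable (fun x => 8 * θ * (M x ^ 2 * |M x|)) P := hi3'.const_mul _
  have hI1 : Integrable (fun x => 8 * θ * (M x ^ 2 * |M x|) + 24 * θ ^ 2 * M x ^ 2) P :=
    hi3.add (hiM2.const_mul _)
  have hI2 : Integrable (fun x => 8 * θ * (M x ^ 2 * |M x|) + 24 * θ ^ 2 * M x ^ 2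
      + 32 * θ ^ 3 * |M x|) P := hI1.add (hiMa.const_mul _)
  have hiR : Integrable (fun x => 8 * θ * (M x ^ 2 * |M x|) + 24 * θ ^ 2 * M x ^ 2
      + 32 * θ ^ 3 * |M x| + 16 * θ ^ 4) P := hI2.add (integrable_const _)
  -- moments of `M`
  have hn1 : (1 : ℝ) ≤ n := Nat.one_le_cast.2 (Nat.pos_of_ne_zero hn)
  have hn0 : (0 : ℝ) ≤ n := by linarith
  have hs1 : 1 ≤ Real.sqrt n := by rw [← Real.sqrt_one]; exact Real.sqrt_le_sqrt hn1
  have hnn : (n : ℝ) ≤ n * Real.sqrt n := le_mul_of_one_le_right hn0 hs1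
  have hsn : Real.sqrt n ≤ n * Real.sqrt n := le_mul_of_one_le_left (by positivity) hn1
  have h1n : (1 : ℝ) ≤ n * Real.sqrt n := one_le_mul_of_one_le_of_one_le hn1 hs1
  have hE3 := chain_blockMartingale_cube_le κ μ₀ hh hCh s hn
  have hE2 := chain_blockMartingale_sq_le κ μ₀ hh hCh s n
  have hE1 := chain_blockMartingale_abs_le κ μ₀ hh hCh s n
  have hE4 := abs_chain_blockMartingale_fourth_sub_leading_le_of_envelope μ₀ henv hA hρ0 hρ1 hh hCh s hn
  rw [← hP] at hE3 hE2 hE1 hE4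
  -- `|E S⁴ − E M⁴| ≤ 128 θ⁴ n √n`
  have hdiff : |∫ x, (∑ t ∈ Finset.range n, (f (x (s + t)) - c)) ^ 4 ∂P - ∫ x, M x ^ 4 ∂P|
      ≤ 128 * θ ^ 4 * (n * Real.sqrt n) := by
    rw [← integral_sub hiS hiM4]
    calc |∫ x, ((∑ t ∈ Finset.range n, (f (x (s + t)) - c)) ^ 4 - M x ^ 4) ∂P|
        = ‖∫ x, ((∑ t ∈ Finset.range n, (f (x (s + t)) - c)) ^ 4 - M x ^ 4) ∂P‖ :=
          (Real.norm_eq_abs _).symm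
      _ ≤ ∫ x, ‖(∑ t ∈ Finset.range n, (f (x (s + t)) - c)) ^ 4 - M x ^ 4‖ ∂P :=
          norm_integral_le_integral_norm _
      _ ≤ ∫ x, (8 * θ * (M x ^ 2 * |M x|) + 24 * θ ^ 2 * M x ^ 2 + 32 * θ ^ 3 * |M x| + 16 * θ ^ 4) ∂P := by
          refine integral_mono_of_nonneg (ae_of_all _ fun x => norm_nonneg _) hiR
            (ae_of_all _ fun x => ?_)
          show ‖(∑ t ∈ Finset.range n, (f (x (s + t)) - c)) ^ 4 - M x ^ 4‖ ≤ _
          rw [Real.norm_eq_abs]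
          exact hpt x
      _ = ∫ x, 8 * θ * (M x ^ 2 * |M x|) ∂P + 24 * θ ^ 2 * ∫ x, M x ^ 2 ∂P
          + 32 * θ ^ 3 * ∫ x, |M x| ∂P + 16 * θ ^ 4 := by
          rw [integral_add hI2 (integrable_const _), integral_add hI1 (hiMa.const_mul _),
            integral_add hi3 (hiM2.const_mul _), integral_const_mul, integral_const_mul,
            integral_const_mul, integral_const, probReal_univ, one_smul]
      _ ≤ 56 * θ ^ 4 * (n * Real.sqrt n) + 24 * θ ^ 2 * (n * θ ^ 2)
          + 32 * θ ^ 3 * (θ * Real.sqrt n) + 16 * θ ^ 4 := by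
          refine add_le_add (add_le_add (add_le_add hE3 ?_) ?_) le_rfl
          · exact mul_le_mul_of_nonneg_left hE2 (by positivity)
          · exact mul_le_mul_of_nonneg_left hE1 (by positivity)
      _ = 56 * θ ^ 4 * (n * Real.sqrt n) + 24 * θ ^ 4 * n + 32 * θ ^ 4 * Real.sqrt n + 16 * θ ^ 4 := by
          ring
      _ ≤ 56 * θ ^ 4 * (n * Real.sqrt n) + 24 * θ ^ 4 * (n * Real.sqrt n)
          + 32 * θ ^ 4 * (n * Real.sqrt n) + 16 * θ ^ 4 * (n * Real.sqrt n) := by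
          have hθ4 : 0 ≤ θ ^ 4 := by positivity
          refine add_le_add (add_le_add (add_le_add le_rfl ?_) ?_) ?_
          · exact mul_le_mul_of_nonneg_left hnn (by positivity)
          · exact mul_le_mul_of_nonneg_left hsn (by positivity)
          · calc 16 * θ ^ 4 = 16 * θ ^ 4 * 1 := (mul_one _).symm
              _ ≤ 16 * θ ^ 4 * (n * Real.sqrt n) := mul_le_mul_of_nonneg_left h1n (by positivity)
      _ = 128 * θ ^ 4 * (n * Real.sqrt n) := by ring
  -- combine with the martingale's leading constant
  have hsplit : ∫ x, (∑ t ∈ Finset.range n, (f (x (s + t)) - c)) ^ 4 ∂P - 3 * mq ^ 2 * (n : ℝ) ^ 2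
      = (∫ x, (∑ t ∈ Finset.range n, (f (x (s + t)) - c)) ^ 4 ∂P - ∫ x, M x ^ 4 ∂P)
        + (∫ x, M x ^ 4 ∂P - 3 * mq ^ 2 * (n : ℝ) ^ 2) := by ring
  rw [hsplit]
  calc |(∫ x, (∑ t ∈ Finset.range n, (f (x (s + t)) - c)) ^ 4 ∂P - ∫ x, M x ^ 4 ∂P)
        + (∫ x, M x ^ 4 ∂P - 3 * mq ^ 2 * (n : ℝ) ^ 2)|
      ≤ |∫ x, (∑ t ∈ Finset.range n, (f (x (s + t)) - c)) ^ 4 ∂P - ∫ x, M x ^ 4 ∂P|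
        + |∫ x, M x ^ 4 ∂P - 3 * mq ^ 2 * (n : ℝ) ^ 2| := abs_add_le _ _
    _ ≤ 128 * θ ^ 4 * (n * Real.sqrt n)
        + (12 * θ ^ 4 * A / (1 - ρ) + 6 * ((8 * θ ^ 4 * A + 32 * θ ^ 4 * A ^ 2 / (1 - ρ)) / (1 - ρ))
          + 16 * θ ^ 4 + 35 * θ ^ 4) * (n * Real.sqrt n) := add_le_add hdiff hE4
    _ = (12 * θ ^ 4 * A / (1 - ρ) + 6 * ((8 * θ ^ 4 * A + 32 * θ ^ 4 * A ^ 2 / (1 - ρ)) / (1 - ρ))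
          + 179 * θ ^ 4) * (n * Real.sqrt n) := by ring

end Envelope

end Summit.Ventures.LatticeQCDFlow.Scoring

end
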